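import Mathlib
import Literature.MathematicalPhysics.QuantumFieldTheory.Balaban1983to89.B9
import Literature.MathematicalPhysics.QuantumFieldTheory.Balaban1983to89.B6Cor28
import Literature.MathematicalPhysics.QuantumFieldTheory.Balaban1983to89.B9FromB6

/-!
# `Balaban1983to89.B9Ineq349` — the composition estimate (3.49) of B9, kernel-checked as multiscale power counting

T. Bałaban, *Propagators for lattice gauge theories in a background field*, Commun. Math. Phys. **99**, 389–434
(1985) [Balaban1985BackgroundPropagators] (cell paper B9; PDF held `paper:balaban1985-cmp99-background-propagators`,
journal page = PDF page + 388).  Sibling of `…Balaban1983to89.B9` (units b2b-balaban-r1 / b09 — UNTOUCHED; its leaf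
`B9.Ineq349` is CONCLUDED here by name) and of `…Balaban1983to89.B6Cor28` (unit pv01: the same three-factor
composition for [4] = [Balaban1984PropagatorsII] (2.88) p. 238, whose scale-transfer machinery `TransferL/R`,
`transfer_of_260`, `Conv3`, `comp3` is reused, not restated; the sign lemma `B9FromB6.pref4_nonneg` of unit b09's edge
module `…B9FromB6` likewise).

CITATION HEADER (lean-in-tree rule 2026-08-18).  This module is a KERNEL-CHECKED BOOKKEEPING STEP of the published
paper [Balaban1985BackgroundPropagators], p. 399 [PDF 11], verbatim: *"These theorems imply all the properties of the
operator R, or DRD\*, we will need in the future. For the operator P = I − R we obtain, using again Lemma 2.1,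
\[|P(x, x′)|, |(DP)_μ(x, x′)|, |(PD\*)_ν(x, x′)|, |(DPD\*)_{μν}(x, x′)|\] ≦ O(1)\[1, (L^jη)^{−1}, (L^jη)^{−1}, (L^jη)^{−2}\]
(L^{j′}η)^{−d}e^{−(1/2)δ₀d(y,y′)} for x ∈ Δ(y), y ∈ Λ_j, x′ ∈ Δ(y′), y′ ∈ Λ_{j′}. (3.49)  We have also the corresponding
bounds for Hölder norms of the kernel (DPD\*)_{μν}(x, x′).  Thus the operator Δ_a is well defined."*  Here "these
theorems" = Theorems 3.1, 3.2 (pp. 397–398 [PDF 9–10]: (3.42), (3.48); typed in `…B9` as `B9.Ineq342_346_347`,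
`B9.Thms31to33IneqAt`), "Lemma 2.1" = Lemma 2.1 of [4] = [Balaban1984PropagatorsII], (2.60)–(2.63) p. 234 (typed in
`…B6`, `…B6RandomWalk`), and P = I − R is, by (3.25) p. 394 [PDF 6] (verbatim: *"Rf = (I − G′Q′\*(Q′G′²Q′\*)^{−1}Q′G′)f,
(3.25) where G′ = G′(U) = (Δ′_a)^{−1}"*), the COMPOSITE P = G′Q′\*(Q′G′²Q′\*)^{−1}Q′G′ — three factors, no identity
term (R is the orthogonal projection onto Δ_U N(Q′), (3.21)).

WHAT IS REPRODUCED (0 sorry): the derivation the print calls routine and does not display (cell GAPS row G-B9-12,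
"asserted-routine; derivation not displayed") — the SECOND inequality behind (3.49).  If the three factors of (3.25)
have site kernels bounded as the entries (3.42) of Theorem 3.1 — left factor D^aG′Q′\* by entry a ∈ {0, 1} (|G′λ|,
|∇_U G′λ|: prefactors (L^jη)², L^jη) at the observation site y with a test function localised in Δ(y₁) of sup norm
≤ 1; right factor Q′G′D\*^b = (D^bG′Q′\*)\* by entry b at y′ with a test function localised in Δ(y₂) — and as (3.48)
of Theorem 3.2 (middle factor, (L^{j₁}η)^{−4}(L^{j₂}η)^{−d}e^{−δ₁d(y₁,y₂)}), then ONE application of Lemma 2.1 of [4]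
— the scale transfers from (2.60) (`B6Cor28.transfer_of_260`: (L^{j₁}η)^{−4} ↦ (L^jη)^{−4}, (L^{j₂}η)^{−d} ↦
(L^{j′}η)^{−d}, (L^{j′}η)^{q} ↦ (L^jη)^{q} across the chain by the triangle inequality (2.54)) and the three-factor
convolution (2.63), n = 3 (`conv3_of_261`, from the (2.61) row-sum bound by `B6RandomWalk.chain_split` /
`openChain_le_pow`) — gives the four right-hand sides of (3.49): the powers \[1, (L^jη)^{−1}, (L^jη)^{−1},
(L^jη)^{−2}\] ARE (L^jη)^{p+q−4} for the entry powers (p, q) = (2,2), (1,2), (2,1), (1,1) of the four kernels P, DP,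
PD\*, DPD\* (`comp3_kernel_pq`, `powL`, `powR`, `pref4inv_eq_rpow`); the rate is ½δ₀ whenever (1−α)δ ≥ ½δ₀,
(1+2α)δ ≤ δ₀, (1+α)δ ≤ δ₁ (attainable with α ≤ ¼ when δ₁ = δ₀ as printed — "δ determined by δ₀" made explicit,
`rates_349`); and O(1) = B₀²B₁·L⁴·L^d·L²·c³ is EXPLICIT (c = the (2.61) constant, c₁(α) in [4]).  Main theorems:
`ineq349_kernel` (transfers and convolution as hypotheses over the carrier of `…B9`) and `ineq349_of_thms31to33`
(transfers and convolution DISCHARGED from the (2.60)/(2.61) shapes), both concluding the tree's leaf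
`B9.Ineq349 d P C δ₀ U` by name.

WHAT IS NOT REPRODUCED (hypotheses, each named — none is a cited fact): (i) the KERNEL-COMPOSITION DICTIONARY `hP` —
that the (3.49)-entries of P are dominated by the plain double sum over 𝔅 × 𝔅 of the three factor kernels ((3.25)
written in kernels, including the normalisation of coarse kernels per unit coarse measure which the factor
(L^{j′}η)^{−d} of (3.48) reflects: the block volumes (L^{j₁}η)^d(L^{j₂}η)^d of the coarse measure cancel against the
normalisation of the two coarse δ-functions) — and the TEST-FUNCTION DICTIONARY `ObservedBy` (λ = Q′\*χ with
supp λ ⊂ Δ(y₁), |λ| ≤ 1); neither is displayed in print (cell GAPS row G-pv16-1: located, not an objection);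
(ii) Theorems 3.1/3.2 themselves (`B9.Thms31to33IneqAt`, a hypothesis; the whole predicate incl. Thm 3.3's G and the
Hölder entries is taken, only (3.42) for G′ and (3.48) are used); (iii) Lemma 2.1 of [4] for THIS paper's geometry —
entered as the (2.60)- and (2.61)-shaped hypotheses `h260`, `h261` over `B9.Geometry` with the parameter R of [4]
(2.1)–(2.2) as a binder (the tree's `B6.Lemma21Printed` is typed over `B6.Geometry`; B9 p. 393: the sequence (2.1)
starts with Ω₀, (2.2) unchanged) and the largeness L⁴, L^d ≤ e^{αδRM} of the M-threshold; (iv) the Hölder-norm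
sentence for (DPD\*)_{μν} and "Thus the operator Δ_a is well defined" (LOCATED only, not typed); (v) sign facts of the
abstract carrier invisible to `…B9`'s structures (1 ≤ L, 0 < η, d(·,·) ≥ 0 symmetric with the triangle inequality
(2.54), B₀, B₁ ≥ 0, 𝔅 finite = a `Fintype` instance on the abstract site type) — explicit hypotheses.  NOTHING of the
series' end-statement (ultraviolet stability, [Balaban1987RG1] Thm 2 ff., under adjudication by the cell
`pub-balaban`) is asserted; value = kernel-checked bookkeeping of a printed "we obtain", NOT summit progress.
Unit `b2b-balaban-pv16` (surge node prover #16), second-pass SHARPEN of node T06.3; cell rows C-pv16-1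
(certification), G-pv16-1 (located dictionary), D-pv16.1 (the cell census row GAPS G-B9-12 calls the composite
"R = G′Q′\*(Q′G′²Q′\*)^{−1}Q′G′ (3.24)"; by (3.25) p. 394 that composite is P = I − R — R itself is the orthogonal
projection (3.21) — and (3.24) is the form ⟨λ, Q′\*aQ′λ⟩; a naming slip in a census row: the docstring of the leaf
`B9.Ineq349` has it right ("composition G′Q′\*(Q′G′²Q′\*)^{−1}Q′G′" for P = I − R) and the typed statement is
unaffected).  v1.1 (same unit): this attribution corrected (v1 said the slip was in the leaf docstring); no
declaration changed.
-/

namespace Literature.MathematicalPhysics.QuantumFieldTheory.Balaban1983to89.B9Ineq349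

open B6Cor28 (TransferR TransferL Conv3 comp3)

/-! ## Generic three-factor power counting over a finite multiscale set (the "using again Lemma 2.1" step) -/
section Generic

variable {S : Type} [Fintype S]

omit [Fintype S] in
/-- A scale transfer with constant A is one with any larger constant A′ (ℓ > 0). [folklore] -/
theorem transferL_mono (ℓ : S → ℝ) (dist : S → S → ℝ) (ε q A A' : ℝ) (hℓ : ∀ y, 0 < ℓ y) (hA : A ≤ A')
    (h : TransferL ℓ dist ε q A) : TransferL ℓ dist ε q A' := fun a b =>
  (h a b).trans (mul_le_mul_of_nonneg_right (mul_le_mul_of_nonneg_right hA (Real.exp_nonneg _))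
    (Real.rpow_nonneg (le_of_lt (hℓ a)) _))

/-- **Three-factor multiscale power counting with real outer powers** (the pattern of [4] (2.88) p. 238 and of B9
(3.49) p. 399).  Over a finite multiscale set with `ℓ > 0`, a distance `d ≥ 0` obeying the triangle inequality (2.54):
if `|K₁(y,y₁)| ≤ C₁ ℓ(y)^p e^{−a d(y,y₁)}`, `|K₂(y₁,y₂)| ≤ C₂ ℓ(y₁)^{−4} ℓ(y₂)^{−d} e^{−b d(y₁,y₂)}` ((3.48)) and
`|K₃(y₂,y′)| ≤ C₃ ℓ(y′)^q e^{−c d(y₂,y′)}`, the scale transfers `ℓ(y₁)^{−4} ↦ ℓ(y)^{−4}` (constant A₄),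
`ℓ(y₂)^{−d} ↦ ℓ(y′)^{−d}` (A_d), `ℓ(y′)^{q} ↦ ℓ(y)^{q}` (A_q, across the chain via (2.54)) at rate `ε ≥ 0`, and the
convolution (2.63) at a rate `δ` with `δ + 2ε ≤ a`, `δ + ε ≤ b`, `δ + 2ε ≤ c`, then
`|Σ_{y₁,y₂} K₁K₂K₃| ≤ C₁C₂C₃A₄A_dA_qC_c · ℓ(y)^{p+q−4} ℓ(y′)^{−d} e^{−θ d(y,y′)}`.  (`B6Cor28.ineq288_kernel` is the
case p = q = 1.) [cite: Balaban1985BackgroundPropagators, (3.49) p.399; Balaban1984PropagatorsII, (2.88) p.238] -/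
theorem comp3_kernel_pq (ℓ : S → ℝ) (dist : S → S → ℝ) (d : ℕ) (K₁ K₂ K₃ : S → S → ℝ)
    (p q C₁ C₂ C₃ a b c ε δ A₄ Ad Aq Cc θ : ℝ)
    (hℓ : ∀ y, 0 < ℓ y) (hdist : ∀ y y', 0 ≤ dist y y')
    (htri : ∀ x y z : S, dist x z ≤ dist x y + dist y z)
    (hC₁ : 0 ≤ C₁) (hC₂ : 0 ≤ C₂) (hC₃ : 0 ≤ C₃) (hA₄ : 0 ≤ A₄) (hAd : 0 ≤ Ad) (hAq : 0 ≤ Aq) (hε : 0 ≤ ε)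
    (ha : δ + 2 * ε ≤ a) (hb : δ + ε ≤ b) (hc : δ + 2 * ε ≤ c)
    (hK₁ : ∀ y y₁, |K₁ y y₁| ≤ C₁ * ℓ y ^ p * Real.exp (-(a * dist y y₁)))
    (hK₂ : ∀ y₁ y₂, |K₂ y₁ y₂| ≤
      C₂ * ℓ y₁ ^ (-(4 : ℝ)) * ℓ y₂ ^ (-(d : ℝ)) * Real.exp (-(b * dist y₁ y₂)))
    (hK₃ : ∀ y₂ y', |K₃ y₂ y'| ≤ C₃ * ℓ y' ^ q * Real.exp (-(c * dist y₂ y')))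
    (hT₄ : TransferL ℓ dist ε (-(4 : ℝ)) A₄) (hTd : TransferR ℓ dist ε (-(d : ℝ)) Ad)
    (hTq : TransferL ℓ dist ε q Aq) (hConv : Conv3 dist δ Cc θ) (y y' : S) :
    |comp3 K₁ K₂ K₃ y y'| ≤ C₁ * C₂ * C₃ * A₄ * Ad * Aq * Cc *
      ℓ y ^ (p + q - 4) * ℓ y' ^ (-(d : ℝ)) * Real.exp (-(θ * dist y y')) := by
  unfold B6Cor28.comp3
  have hy : 0 < ℓ y := hℓ y
  have hy' : 0 < ℓ y' := hℓ y'
  set M : ℝ := C₁ * C₂ * C₃ * A₄ * Ad * Aq * ℓ y ^ (p + q - 4) * ℓ y' ^ (-(d : ℝ)) with hM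
  have hypq : 0 ≤ ℓ y ^ (p + q - 4) := Real.rpow_nonneg (le_of_lt hy) _
  have hyd : 0 ≤ ℓ y' ^ (-(d : ℝ)) := Real.rpow_nonneg (le_of_lt hy') _
  have hMnn : 0 ≤ M := by rw [hM]; positivity
  -- the weight of the convolution
  set w : S → S → ℝ := fun u v => Real.exp (-(δ * dist u v)) with hw
  -- termwise bound
  have key : ∀ y₁ y₂, |K₁ y y₁ * K₂ y₁ y₂ * K₃ y₂ y'| ≤ M * (w y y₁ * (w y₁ y₂ * w y₂ y')) := by
    intro y₁ y₂
    have h1p : 0 < ℓ y₁ := hℓ y₁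
    have h2p : 0 < ℓ y₂ := hℓ y₂
    have E₁ := hdist y y₁
    have E₂ := hdist y₁ y₂
    have E₃ := hdist y₂ y'
    have hyp : 0 ≤ ℓ y ^ p := Real.rpow_nonneg (le_of_lt hy) _
    have hyq : 0 ≤ ℓ y ^ q := Real.rpow_nonneg (le_of_lt hy) _
    have hy14 : 0 ≤ ℓ y₁ ^ (-(4 : ℝ)) := Real.rpow_nonneg (le_of_lt h1p) _
    have hy2d : 0 ≤ ℓ y₂ ^ (-(d : ℝ)) := Real.rpow_nonneg (le_of_lt h2p) _
    have hym4 : 0 ≤ ℓ y ^ (-(4 : ℝ)) := Real.rpow_nonneg (le_of_lt hy) _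
    -- the three kernel bounds, with the scales transferred to the end-points
    have b1 := hK₁ y y₁
    have t4 : ℓ y₁ ^ (-(4 : ℝ)) ≤ A₄ * Real.exp (ε * dist y y₁) * ℓ y ^ (-(4 : ℝ)) := hT₄ y y₁
    have td : ℓ y₂ ^ (-(d : ℝ)) ≤ Ad * Real.exp (ε * dist y₂ y') * ℓ y' ^ (-(d : ℝ)) := hTd y₂ y'
    have tq : ℓ y' ^ q ≤ Aq * Real.exp (ε * (dist y y₁ + dist y₁ y₂ + dist y₂ y')) * ℓ y ^ q := by
      have h := hTq y y'
      have hd : dist y y' ≤ dist y y₁ + dist y₁ y₂ + dist y₂ y' :=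
        le_trans (htri y y₁ y') (by linarith [htri y₁ y₂ y'])
      have he : Real.exp (ε * dist y y') ≤ Real.exp (ε * (dist y y₁ + dist y₁ y₂ + dist y₂ y')) :=
        Real.exp_le_exp.mpr (mul_le_mul_of_nonneg_left hd hε)
      exact h.trans (mul_le_mul_of_nonneg_right (mul_le_mul_of_nonneg_left he hAq) hyq)
    have b2 : |K₂ y₁ y₂| ≤ C₂ * (A₄ * Real.exp (ε * dist y y₁) * ℓ y ^ (-(4 : ℝ))) *
        (Ad * Real.exp (ε * dist y₂ y') * ℓ y' ^ (-(d : ℝ))) * Real.exp (-(b * dist y₁ y₂)) := by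
      refine (hK₂ y₁ y₂).trans ?_
      have : C₂ * ℓ y₁ ^ (-(4 : ℝ)) * ℓ y₂ ^ (-(d : ℝ)) ≤
          C₂ * (A₄ * Real.exp (ε * dist y y₁) * ℓ y ^ (-(4 : ℝ))) *
            (Ad * Real.exp (ε * dist y₂ y') * ℓ y' ^ (-(d : ℝ))) :=
        mul_le_mul (mul_le_mul_of_nonneg_left t4 hC₂) td hy2d (by positivity)
      exact mul_le_mul_of_nonneg_right this (Real.exp_nonneg _)
    have b3 : |K₃ y₂ y'| ≤ C₃ * (Aq * Real.exp (ε * (dist y y₁ + dist y₁ y₂ + dist y₂ y')) * ℓ y ^ q) *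
        Real.exp (-(c * dist y₂ y')) := by
      refine (hK₃ y₂ y').trans ?_
      exact mul_le_mul_of_nonneg_right (mul_le_mul_of_nonneg_left tq hC₃) (Real.exp_nonneg _)
    -- multiply the three bounds
    have prod : |K₁ y y₁ * K₂ y₁ y₂ * K₃ y₂ y'| ≤
        (C₁ * ℓ y ^ p * Real.exp (-(a * dist y y₁))) *
        (C₂ * (A₄ * Real.exp (ε * dist y y₁) * ℓ y ^ (-(4 : ℝ))) *
          (Ad * Real.exp (ε * dist y₂ y') * ℓ y' ^ (-(d : ℝ))) * Real.exp (-(b * dist y₁ y₂))) *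
        (C₃ * (Aq * Real.exp (ε * (dist y y₁ + dist y₁ y₂ + dist y₂ y')) * ℓ y ^ q) *
          Real.exp (-(c * dist y₂ y'))) := by
      rw [abs_mul, abs_mul]
      apply mul_le_mul (mul_le_mul b1 b2 (abs_nonneg _) (by positivity)) b3 (abs_nonneg _)
      positivity
    -- collect: the scale powers ℓ(y)^p ℓ(y)^{−4} ℓ(y)^q = ℓ(y)^{p+q−4} and the exponentials
    have hpow : ℓ y ^ p * ℓ y ^ (-(4 : ℝ)) * ℓ y ^ q = ℓ y ^ (p + q - 4) := by
      rw [← Real.rpow_add hy, ← Real.rpow_add hy]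
      congr 1
      ring
    have hexp : Real.exp (-(a * dist y y₁)) * Real.exp (ε * dist y y₁) * Real.exp (ε * dist y₂ y') *
        Real.exp (-(b * dist y₁ y₂)) * Real.exp (ε * (dist y y₁ + dist y₁ y₂ + dist y₂ y')) *
        Real.exp (-(c * dist y₂ y')) ≤ w y y₁ * (w y₁ y₂ * w y₂ y') := by
      rw [hw]
      simp only [← Real.exp_add]
      apply Real.exp_le_exp.mpr
      have i1 := mul_le_mul_of_nonneg_right ha E₁
      have i2 := mul_le_mul_of_nonneg_right hb E₂
      have i3 := mul_le_mul_of_nonneg_right hc E₃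
      nlinarith
    calc |K₁ y y₁ * K₂ y₁ y₂ * K₃ y₂ y'|
        ≤ _ := prod
      _ = (C₁ * C₂ * C₃ * A₄ * Ad * Aq * (ℓ y ^ p * ℓ y ^ (-(4 : ℝ)) * ℓ y ^ q) *
            ℓ y' ^ (-(d : ℝ))) *
          (Real.exp (-(a * dist y y₁)) * Real.exp (ε * dist y y₁) * Real.exp (ε * dist y₂ y') *
            Real.exp (-(b * dist y₁ y₂)) * Real.exp (ε * (dist y y₁ + dist y₁ y₂ + dist y₂ y')) *
            Real.exp (-(c * dist y₂ y'))) := by ring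
      _ = M * (Real.exp (-(a * dist y y₁)) * Real.exp (ε * dist y y₁) * Real.exp (ε * dist y₂ y') *
            Real.exp (-(b * dist y₁ y₂)) * Real.exp (ε * (dist y y₁ + dist y₁ y₂ + dist y₂ y')) *
            Real.exp (-(c * dist y₂ y'))) := by rw [hpow, hM]
      _ ≤ M * (w y y₁ * (w y₁ y₂ * w y₂ y')) := mul_le_mul_of_nonneg_left hexp hMnn
  -- sum over the two intermediate points and convolve
  have hconv : ∑ y₁, w y y₁ * ∑ y₂, w y₁ y₂ * w y₂ y' ≤ Cc * Real.exp (-(θ * dist y y')) := by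
    have h := hConv y y'
    simpa [hw] using h
  calc |∑ y₁, ∑ y₂, K₁ y y₁ * K₂ y₁ y₂ * K₃ y₂ y'|
      ≤ ∑ y₁, |∑ y₂, K₁ y y₁ * K₂ y₁ y₂ * K₃ y₂ y'| := Finset.abs_sum_le_sum_abs _ _
    _ ≤ ∑ y₁, ∑ y₂, |K₁ y y₁ * K₂ y₁ y₂ * K₃ y₂ y'| :=
        Finset.sum_le_sum fun y₁ _ => Finset.abs_sum_le_sum_abs _ _
    _ ≤ ∑ y₁, ∑ y₂, M * (w y y₁ * (w y₁ y₂ * w y₂ y')) :=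
        Finset.sum_le_sum fun y₁ _ => Finset.sum_le_sum fun y₂ _ => key y₁ y₂
    _ = M * ∑ y₁, w y y₁ * ∑ y₂, w y₁ y₂ * w y₂ y' := by
        simp only [Finset.mul_sum]
    _ ≤ M * (Cc * Real.exp (-(θ * dist y y'))) := mul_le_mul_of_nonneg_left hconv hMnn
    _ = C₁ * C₂ * C₃ * A₄ * Ad * Aq * Cc * ℓ y ^ (p + q - 4) * ℓ y' ^ (-(d : ℝ)) *
          Real.exp (-(θ * dist y y')) := by rw [hM]; ring

/-- **(2.61) ⇒ (2.63) with two intermediate points, over any finite carrier**: if every row sum of `e^{−αδ d}` is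
`≤ c` (the shape of [4] (2.61), c = c₁(α)) and d obeys the triangle inequality (2.54), then for `0 ≤ δ`, `α ≤ 1`
`Σ_{y₁} e^{−δd(y,y₁)} Σ_{y₂} e^{−δd(y₁,y₂)} e^{−δd(y₂,y′)} ≤ c³ e^{−(1−α)δ d(y,y′)}` — by the tree's generic chain
lemmas `B6RandomWalk.chain_split` ((2.55)_b), `chain_le_openChain` ((2.56)), `openChain_le_pow` ((2.62)).
[cite: Balaban1984PropagatorsII, Lemma 2.1 (2.61)–(2.63) p.234] -/
theorem conv3_of_261 (dist : S → S → ℝ) (htri : ∀ x y z : S, dist x z ≤ dist x y + dist y z)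
    (δ α c : ℝ) (hδ : 0 ≤ δ) (hα : α ≤ 1)
    (h261 : ∀ y : S, ∑ y' : S, Real.exp (-(α * δ * dist y y')) ≤ c) :
    Conv3 dist δ (c ^ 3) ((1 - α) * δ) := by
  intro y y'
  have hsplit := B6RandomWalk.chain_split dist htri δ α (mul_nonneg (by linarith) hδ) 2 y y'
  have hopen : B6RandomWalk.chain (fun a b => Real.exp (-(α * δ * dist a b))) 2 y y' ≤ c ^ (2 + 1) :=
    le_trans (B6RandomWalk.chain_le_openChain _ (fun _ _ => Real.exp_nonneg _) 2 y y')
      (B6RandomWalk.openChain_le_pow _ (fun _ _ => Real.exp_nonneg _) c h261 2 y)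
  have h3 : B6RandomWalk.chain (fun a b => Real.exp (-(δ * dist a b))) 2 y y' ≤
      c ^ 3 * Real.exp (-((1 - α) * δ * dist y y')) := by
    calc B6RandomWalk.chain (fun a b => Real.exp (-(δ * dist a b))) 2 y y'
        ≤ Real.exp (-((1 - α) * δ * dist y y')) *
            B6RandomWalk.chain (fun a b => Real.exp (-(α * δ * dist a b))) 2 y y' := hsplit
      _ ≤ Real.exp (-((1 - α) * δ * dist y y')) * c ^ (2 + 1) :=
          mul_le_mul_of_nonneg_left hopen (Real.exp_nonneg _)
      _ = c ^ 3 * Real.exp (-((1 - α) * δ * dist y y')) := by rw [mul_comm]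
  simpa [B6RandomWalk.chain] using h3

end Generic

/-! ## Over the carrier of `…B9`: the entries of (3.49) from (3.42), (3.48) and Lemma 2.1 -/
section B9Carrier

variable {g : B9.Geometry} {B : B9.Backgrounds}

/-- `B9.Geometry.len` (L^jη, a natural-number power in `…B9`) as a real power. [folklore] -/
theorem len_eq_rpow (g : B9.Geometry) : g.len = fun y => g.L ^ (g.scale y : ℝ) * g.eta := by
  funext y
  simp [B9.Geometry.len, Real.rpow_natCast]

/-- `L^jη > 0` from `1 ≤ L`, `0 < η`. [folklore] -/
theorem len_pos (g : B9.Geometry) (hL : 1 ≤ g.L) (hη : 0 < g.eta) (y : g.Site) : 0 < g.len y := by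
  unfold B9.Geometry.len
  have hL0 : 0 < g.L := lt_of_lt_of_le one_pos hL
  positivity

/-- The entry of (3.42) observing the LEFT factor of (3.25) in the n-th kernel of (3.49) (n = 0 … 3 for P, DP, PD\*,
DPD\*): D^aG′Q′\* with a = 0, 1, 0, 1, i.e. entry 0 (|G′λ|) or entry 1 (|∇_U G′λ|). [cite: Balaban1985BackgroundPropagators, (3.25) p.394 + (3.42) p.397 + (3.49) p.399] -/
def entL : Fin 4 → Fin 4 := ![0, 1, 0, 1]

/-- The entry of (3.42) observing the RIGHT factor of (3.25) in the n-th kernel of (3.49): Q′G′D\*^b = (D^bG′Q′\*)\*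
with b = 0, 0, 1, 1 (observed at y′, localised at y₂). [cite: Balaban1985BackgroundPropagators, (3.25) p.394 + (3.42) p.397 + (3.49) p.399] -/
def entR : Fin 4 → Fin 4 := ![0, 0, 1, 1]

/-- The scale powers p = 2, 1, 2, 1 of the left factor ((L^jη)² for G′, L^jη for ∇G′). [cite: Balaban1985BackgroundPropagators, (3.42) p.397] -/
def powL : Fin 4 → ℝ := ![2, 1, 2, 1]

/-- The scale powers q = 2, 2, 1, 1 of the right factor. [cite: Balaban1985BackgroundPropagators, (3.42) p.397] -/
def powR : Fin 4 → ℝ := ![2, 2, 1, 1]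

/-- The (3.42) prefactor of the left entry as a real power: `pref4 t (entL n) = t^{p_n}`. [folklore] -/
theorem pref4_entL (t : ℝ) : ∀ n : Fin 4, B9.pref4 t (entL n) = t ^ powL n := by
  intro n
  fin_cases n
  · show t ^ 2 = t ^ (2 : ℝ); rw [Real.rpow_two]
  · show t = t ^ (1 : ℝ); rw [Real.rpow_one]
  · show t ^ 2 = t ^ (2 : ℝ); rw [Real.rpow_two]
  · show t = t ^ (1 : ℝ); rw [Real.rpow_one]

/-- The (3.42) prefactor of the right entry as a real power: `pref4 t (entR n) = t^{q_n}`. [folklore] -/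
theorem pref4_entR (t : ℝ) : ∀ n : Fin 4, B9.pref4 t (entR n) = t ^ powR n := by
  intro n
  fin_cases n
  · show t ^ 2 = t ^ (2 : ℝ); rw [Real.rpow_two]
  · show t ^ 2 = t ^ (2 : ℝ); rw [Real.rpow_two]
  · show t = t ^ (1 : ℝ); rw [Real.rpow_one]
  · show t = t ^ (1 : ℝ); rw [Real.rpow_one]

/-- **The power counting of (3.49)**: the printed prefactors \[1, (L^jη)^{−1}, (L^jη)^{−1}, (L^jη)^{−2}\]
(`B9.pref4inv`) ARE (L^jη)^{p_n + q_n − 4} — the two (3.42) powers of the outer factors against the (L^jη)^{−4} of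
(3.48). [cite: Balaban1985BackgroundPropagators, (3.49) p.399] -/
theorem pref4inv_eq_rpow (t : ℝ) (ht : 0 < t) : ∀ n : Fin 4, B9.pref4inv t n = t ^ (powL n + powR n - 4) := by
  intro n
  fin_cases n
  · show (1 : ℝ) = t ^ ((2 : ℝ) + 2 - 4)
    rw [show ((2 : ℝ) + 2 - 4) = 0 by norm_num, Real.rpow_zero]
  · show t⁻¹ = t ^ ((1 : ℝ) + 2 - 4)
    rw [show ((1 : ℝ) + 2 - 4) = -1 by norm_num, Real.rpow_neg_one]
  · show t⁻¹ = t ^ ((2 : ℝ) + 1 - 4)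
    rw [show ((2 : ℝ) + 1 - 4) = -1 by norm_num, Real.rpow_neg_one]
  · show t⁻¹ ^ 2 = t ^ ((1 : ℝ) + 1 - 4)
    rw [show ((1 : ℝ) + 1 - 4) = -2 by norm_num, Real.rpow_neg (le_of_lt ht), Real.rpow_two, inv_pow]

/-- Both outer powers lie in [0, 2] (so every transfer constant is ≤ L²). [folklore] -/
theorem powR_bounds : ∀ n : Fin 4, 0 ≤ powR n ∧ powR n ≤ 2 := by
  intro n
  fin_cases n
  · show (0 : ℝ) ≤ 2 ∧ (2 : ℝ) ≤ 2; norm_num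
  · show (0 : ℝ) ≤ 2 ∧ (2 : ℝ) ≤ 2; norm_num
  · show (0 : ℝ) ≤ 1 ∧ (1 : ℝ) ≤ 2; norm_num
  · show (0 : ℝ) ≤ 1 ∧ (1 : ℝ) ≤ 2; norm_num

/-- TEST-FUNCTION DICTIONARY (hypothesis shape, not printed): the site kernel `K(y, y₁)` (a sup over x ∈ Δ(y) of a
fine kernel of an operator built from G′, at the coarse point y₁) is OBSERVED BY entry m of (3.42) — for every pair
there is an argument λ with supp λ ⊂ Δ(y₁) and |λ| ≤ 1 (λ = Q′\*χ, χ the normalised indicator of y₁: Q′\* is a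
piecewise-constant extension with unitary parallel transports) such that `|K(y, y₁)| ≤ (Gp.e m U λ)(y)`.  This is
the unprinted "kernel form" of Theorem 3.1 behind the first inequality of (3.49) (cell GAPS G-pv16-1, located).
[cite: Balaban1985BackgroundPropagators, (3.42) p.397 with (3.49) p.399] -/
def ObservedBy (Gp : B9.KernelFamily g B) (U : B.Cfg) (m : Fin 4) (K : g.Site → g.Site → ℝ) : Prop :=
  ∀ y y₁ : g.Site, ∃ lam : g.Loc, g.suppIn lam y₁ ∧ g.supNorm lam ≤ 1 ∧ |K y y₁| ≤ Gp.e m U lam y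

/-- **Kernel form of an entry of (3.42)**: a kernel observed by entry m (test functions of sup norm ≤ 1) obeys
`|K(y, y₁)| ≤ B₀ · pref4(L^jη)_m · e^{−δ₀d(y,y₁)}` whenever (3.42) holds at U with (B₀, δ₀), B₀ ≥ 0, L^jη ≥ 0.
[cite: Balaban1985BackgroundPropagators, Thm 3.1 (3.42) p.397] -/
theorem kernel_of_342 (Gp : B9.KernelFamily g B) (U : B.Cfg) (B₀ δ₀ : ℝ) (hB₀ : 0 ≤ B₀)
    (hlen : ∀ y : g.Site, 0 ≤ g.len y) (h342 : B9.Ineq342_346_347 Gp B₀ δ₀ U) (m : Fin 4)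
    (K : g.Site → g.Site → ℝ) (hK : ObservedBy Gp U m K) (y y₁ : g.Site) :
    |K y y₁| ≤ B₀ * B9.pref4 (g.len y) m * Real.exp (-(δ₀ * g.dist y y₁)) := by
  obtain ⟨lam, hsupp, hnorm, hle⟩ := hK y y₁
  have h := h342.1 m lam y y₁ hsupp
  have hnn : 0 ≤ B₀ * B9.pref4 (g.len y) m * Real.exp (-(δ₀ * g.dist y y₁)) :=
    mul_nonneg (mul_nonneg hB₀ (B9FromB6.pref4_nonneg (hlen y) m)) (Real.exp_nonneg _)
  calc |K y y₁| ≤ Gp.e m U lam y := hle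
    _ ≤ B₀ * B9.pref4 (g.len y) m * Real.exp (-(δ₀ * g.dist y y₁)) * g.supNorm lam := h
    _ ≤ B₀ * B9.pref4 (g.len y) m * Real.exp (-(δ₀ * g.dist y y₁)) * 1 :=
        mul_le_mul_of_nonneg_left hnorm hnn
    _ = B₀ * B9.pref4 (g.len y) m * Real.exp (-(δ₀ * g.dist y y₁)) := mul_one _

/-- KERNEL-COMPOSITION DICTIONARY (hypothesis shape, not printed): by (3.25), P = I − R = G′Q′\*(Q′G′²Q′\*)^{−1}Q′G′,
so each of the four (3.49)-quantities of P (`P.ker n U y y′` = sup over x ∈ Δ(y), x′ ∈ Δ(y′) of |(D^{a}PD\*^{b})(x,x′)|,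
(a, b) = (0,0), (1,0), (0,1), (1,1)) is dominated by the plain double sum over 𝔅 × 𝔅 of the sup-kernel `K₁ n` of the
left factor D^aG′Q′\*, the absolute kernel of (Q′G′²Q′\*)^{−1} ((3.48)) and the sup-kernel `K₃ n` of the right factor
Q′G′D\*^b — the block volumes of the coarse measure cancelling against the normalisation of the coarse δ-functions
(cell GAPS G-pv16-1, located). [cite: Balaban1985BackgroundPropagators, (3.25) p.394 with (3.48)–(3.49) pp.398–399] -/
def CompDominated [Fintype g.Site] (Cinv : B9.SiteKernel g B) (P : B9.FineKernel g B) (U : B.Cfg)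
    (K₁ K₃ : Fin 4 → g.Site → g.Site → ℝ) : Prop :=
  ∀ (n : Fin 4) (y y' : g.Site), P.ker n U y y' ≤ comp3 (K₁ n) (fun a b => |Cinv.ker U a b|) (K₃ n) y y'

/-- **(3.49) at one configuration, kernel-checked** — transfers and convolution as hypotheses.  At a configuration U
at which the inequalities of Theorems 3.1–3.3 hold (`B9.Thms31to33IneqAt`, constants (B₀, δ₀) for (3.42) and (B₁, δ₁)
for (3.48)), over a finite 𝔅 with 1 ≤ L, 0 < η, d ≥ 0 symmetric obeying (2.54), B₀, B₁ ≥ 0: if the (3.49)-entries of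
P are dominated by the composition of (3.25) (`CompDominated`) whose outer kernels are observed by the entries
`entL n`, `entR n` of (3.42) (`ObservedBy`), and Lemma 2.1 of [4] is available on this carrier as the scale transfers
(constants A₄, A_d, A_q at rate ε ≥ 0) and the three-factor convolution (2.63) (constant C_c, rates δ ↦ θ) with
δ + 2ε ≤ δ₀, δ + ε ≤ δ₁ and θ ≥ ½δ₀, then (3.49) holds at U with the printed rate ½δ₀ and
O(1) = B₀·B₁·B₀·A₄·A_d·A_q·C_c. [cite: Balaban1985BackgroundPropagators, (3.49) p.399] -/
theorem ineq349_kernel [Fintype g.Site] (d : ℕ) (Gp GA : B9.KernelFamily g B) (Cinv : B9.SiteKernel g B)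
    (P : B9.FineKernel g B) (B₀ δ₀ : ℝ) (Bβ Bε : ℝ → ℝ) (Bεβ : ℝ → ℝ → ℝ) (B₁ δ₁ : ℝ) (U : B.Cfg)
    (h : B9.Thms31to33IneqAt d Gp GA Cinv B₀ δ₀ Bβ Bε Bεβ B₁ δ₁ U)
    (hL : 1 ≤ g.L) (hη : 0 < g.eta) (hdist : ∀ y y' : g.Site, 0 ≤ g.dist y y')
    (hsym : ∀ y y' : g.Site, g.dist y y' = g.dist y' y)
    (htri : ∀ a b c : g.Site, g.dist a c ≤ g.dist a b + g.dist b c) (hB₀ : 0 ≤ B₀) (hB₁ : 0 ≤ B₁)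
    (ε δ A₄ Ad Aq Cc θ : ℝ) (hε : 0 ≤ ε) (hA₄ : 0 ≤ A₄) (hAd : 0 ≤ Ad) (hAq : 0 ≤ Aq) (hCc : 0 ≤ Cc)
    (ha : δ + 2 * ε ≤ δ₀) (hb : δ + ε ≤ δ₁) (hθ : δ₀ / 2 ≤ θ)
    (hT₄ : TransferL g.len g.dist ε (-(4 : ℝ)) A₄) (hTd : TransferR g.len g.dist ε (-(d : ℝ)) Ad)
    (hTq : ∀ n : Fin 4, TransferL g.len g.dist ε (powR n) Aq) (hConv : Conv3 g.dist δ Cc θ)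
    (K₁ K₃ : Fin 4 → g.Site → g.Site → ℝ) (hP : CompDominated Cinv P U K₁ K₃)
    (hK₁ : ∀ n : Fin 4, ObservedBy Gp U (entL n) (K₁ n))
    (hK₃ : ∀ n : Fin 4, ObservedBy Gp U (entR n) (fun y' y₂ => K₃ n y₂ y')) :
    B9.Ineq349 d P (B₀ * B₁ * B₀ * A₄ * Ad * Aq * Cc) δ₀ U := by
  intro n y y'
  have hlen := len_pos g hL hη
  have h342 : B9.Ineq342_346_347 Gp B₀ δ₀ U := h.1.1
  have h348 := h.2.1
  -- the three kernel bounds in power form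
  have b1 : ∀ z y₁, |K₁ n z y₁| ≤ B₀ * g.len z ^ powL n * Real.exp (-(δ₀ * g.dist z y₁)) := by
    intro z y₁
    have hz := kernel_of_342 Gp U B₀ δ₀ hB₀ (fun w => (hlen w).le) h342 (entL n) (K₁ n) (hK₁ n) z y₁
    rw [pref4_entL (g.len z) n] at hz
    exact hz
  have b2 : ∀ y₁ y₂, |(fun a b : g.Site => |Cinv.ker U a b|) y₁ y₂| ≤
      B₁ * g.len y₁ ^ (-(4 : ℝ)) * g.len y₂ ^ (-(d : ℝ)) * Real.exp (-(δ₁ * g.dist y₁ y₂)) := by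
    intro y₁ y₂
    simp only [abs_abs]
    exact h348 y₁ y₂
  have b3 : ∀ y₂ z, |K₃ n y₂ z| ≤ B₀ * g.len z ^ powR n * Real.exp (-(δ₀ * g.dist y₂ z)) := by
    intro y₂ z
    have hz := kernel_of_342 Gp U B₀ δ₀ hB₀ (fun w => (hlen w).le) h342 (entR n) (fun y' y₂ => K₃ n y₂ y')
      (hK₃ n) z y₂
    rw [pref4_entR (g.len z) n, hsym z y₂] at hz
    exact hz
  have main := comp3_kernel_pq g.len g.dist d (K₁ n) (fun a b => |Cinv.ker U a b|) (K₃ n)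
    (powL n) (powR n) B₀ B₁ B₀ δ₀ δ₁ δ₀ ε δ A₄ Ad Aq Cc θ hlen hdist htri hB₀ hB₁ hB₀ hA₄ hAd hAq hε
    ha hb ha b1 b2 b3 hT₄ hTd (hTq n) hConv y y'
  -- conclude: the power counting and the rate ½δ₀ ≤ θ
  have hpref : g.len y ^ (powL n + powR n - 4) = B9.pref4inv (g.len y) n :=
    (pref4inv_eq_rpow (g.len y) (hlen y) n).symm
  have hrate : Real.exp (-(θ * g.dist y y')) ≤ Real.exp (-(δ₀ / 2 * g.dist y y')) :=
    Real.exp_le_exp.mpr (neg_le_neg (mul_le_mul_of_nonneg_right hθ (hdist y y')))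
  have hCnn : 0 ≤ B₀ * B₁ * B₀ * A₄ * Ad * Aq * Cc * B9.pref4inv (g.len y) n * g.len y' ^ (-(d : ℝ)) := by
    rw [← hpref]
    have h1 := hlen y
    have h2 := hlen y'
    positivity
  calc P.ker n U y y' ≤ comp3 (K₁ n) (fun a b => |Cinv.ker U a b|) (K₃ n) y y' := hP n y y'
    _ ≤ |comp3 (K₁ n) (fun a b => |Cinv.ker U a b|) (K₃ n) y y'| := le_abs_self _
    _ ≤ B₀ * B₁ * B₀ * A₄ * Ad * Aq * Cc * g.len y ^ (powL n + powR n - 4) * g.len y' ^ (-(d : ℝ)) *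
          Real.exp (-(θ * g.dist y y')) := main
    _ = B₀ * B₁ * B₀ * A₄ * Ad * Aq * Cc * B9.pref4inv (g.len y) n * g.len y' ^ (-(d : ℝ)) *
          Real.exp (-(θ * g.dist y y')) := by rw [hpref]
    _ ≤ B₀ * B₁ * B₀ * A₄ * Ad * Aq * Cc * B9.pref4inv (g.len y) n * g.len y' ^ (-(d : ℝ)) *
          Real.exp (-(δ₀ / 2 * g.dist y y')) := mul_le_mul_of_nonneg_left hrate hCnn

/-- **(3.49) at one configuration from Theorems 3.1–3.2 and Lemma 2.1 of [4], everything but the dictionary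
discharged.**  "Using again Lemma 2.1": Lemma 2.1 of [4] enters on this paper's carrier as the (2.60) shape `h260`
and the (2.61) row-sum shape `h261` at rate αδ (0 ≤ α ≤ 1, δ ≥ 0, R the parameter of [4] (2.1)–(2.2)), with the
largeness L⁴, L^d ≤ e^{αδRM} of the M-threshold; the transfers are then `B6Cor28.transfer_of_260` (constants L⁴, L^d,
L^{q} ≤ L²) and the convolution is `conv3_of_261` (C_c = c³, θ = (1−α)δ).  Rates: (1+2α)δ ≤ δ₀, (1+α)δ ≤ δ₁,
(1−α)δ ≥ ½δ₀ (attainable, `rates_349`).  Conclusion: the tree's leaf `B9.Ineq349 d P C δ₀ U` with the printed rate ½δ₀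
and O(1) = C = B₀²B₁·L⁴·L^d·L²·c³. [cite: Balaban1985BackgroundPropagators, (3.49) p.399; Balaban1984PropagatorsII, Lemma 2.1 p.234] -/
theorem ineq349_of_thms31to33 [Fintype g.Site] (d : ℕ) (Gp GA : B9.KernelFamily g B) (Cinv : B9.SiteKernel g B)
    (P : B9.FineKernel g B) (B₀ δ₀ : ℝ) (Bβ Bε : ℝ → ℝ) (Bεβ : ℝ → ℝ → ℝ) (B₁ δ₁ : ℝ) (U : B.Cfg)
    (h : B9.Thms31to33IneqAt d Gp GA Cinv B₀ δ₀ Bβ Bε Bεβ B₁ δ₁ U)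
    (hL : 1 ≤ g.L) (hη : 0 < g.eta) (hdist : ∀ y y' : g.Site, 0 ≤ g.dist y y')
    (hsym : ∀ y y' : g.Site, g.dist y y' = g.dist y' y)
    (htri : ∀ a b c : g.Site, g.dist a c ≤ g.dist a b + g.dist b c) (hB₀ : 0 ≤ B₀) (hB₁ : 0 ≤ B₁)
    (R α δ c : ℝ) (hα0 : 0 ≤ α) (hα1 : α ≤ 1) (hδ : 0 ≤ δ)
    (h260 : ∀ y y' : g.Site, Real.exp (-(α * δ * g.dist y y')) ≤
      Real.exp (-(α * δ * R * g.M * max (|(g.scale y : ℝ) - (g.scale y' : ℝ)| - 1) 0)))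
    (h261 : ∀ y : g.Site, ∑ y' : g.Site, Real.exp (-(α * δ * g.dist y y')) ≤ c)
    (hl4 : g.L ^ (4 : ℝ) ≤ Real.exp (α * δ * R * g.M)) (hld : g.L ^ (d : ℝ) ≤ Real.exp (α * δ * R * g.M))
    (ha : δ + 2 * (α * δ) ≤ δ₀) (hb : δ + α * δ ≤ δ₁) (hθ : δ₀ / 2 ≤ (1 - α) * δ)
    (K₁ K₃ : Fin 4 → g.Site → g.Site → ℝ) (hP : CompDominated Cinv P U K₁ K₃)
    (hK₁ : ∀ n : Fin 4, ObservedBy Gp U (entL n) (K₁ n))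
    (hK₃ : ∀ n : Fin 4, ObservedBy Gp U (entR n) (fun y' y₂ => K₃ n y₂ y')) :
    B9.Ineq349 d P (B₀ * B₁ * B₀ * g.L ^ (4 : ℝ) * g.L ^ (d : ℝ) * g.L ^ (2 : ℝ) * c ^ 3) δ₀ U := by
  have hL0 : 0 ≤ g.L := le_trans zero_le_one hL
  have hlen := len_pos g hL hη
  -- the transfers of ℓ^{−4} and ℓ^{−d} from (2.60): constants L^{|−4|} = L⁴, L^{|−d|} = L^d
  have e4 : |(-(4 : ℝ))| = 4 := by norm_num
  have ed : |(-(d : ℝ))| = (d : ℝ) := by rw [abs_neg]; exact abs_of_nonneg (Nat.cast_nonneg d)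
  have hT₄ := (B6Cor28.transfer_of_260 g.scale g.dist g.L g.eta (α * δ) R g.M (-(4 : ℝ)) hL hη
    (by rw [e4]; exact hl4) h260).2
  have hTd := (B6Cor28.transfer_of_260 g.scale g.dist g.L g.eta (α * δ) R g.M (-(d : ℝ)) hL hη
    (by rw [ed]; exact hld) h260).1
  rw [e4] at hT₄
  rw [ed] at hTd
  rw [← len_eq_rpow] at hT₄ hTd
  -- the transfers of the right powers q ∈ {2, 1}: constant L^q ≤ L²
  have hTq : ∀ n : Fin 4, TransferL g.len g.dist (α * δ) (powR n) (g.L ^ (2 : ℝ)) := by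
    intro n
    obtain ⟨hq0, hq2⟩ := powR_bounds n
    have hq : |powR n| = powR n := abs_of_nonneg hq0
    have hL2 : g.L ^ powR n ≤ g.L ^ (2 : ℝ) := Real.rpow_le_rpow_of_exponent_le hL hq2
    have hlq : g.L ^ |powR n| ≤ Real.exp (α * δ * R * g.M) := by
      rw [hq]
      exact hL2.trans ((Real.rpow_le_rpow_of_exponent_le hL (by norm_num : (2 : ℝ) ≤ 4)).trans hl4)
    have hT := (B6Cor28.transfer_of_260 g.scale g.dist g.L g.eta (α * δ) R g.M (powR n) hL hη hlq h260).2
    rw [hq, ← len_eq_rpow] at hT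
    exact transferL_mono g.len g.dist (α * δ) (powR n) (g.L ^ powR n) (g.L ^ (2 : ℝ)) hlen hL2 hT
  have hconv := conv3_of_261 g.dist htri δ α c hδ hα1 h261
  have hε : 0 ≤ α * δ := mul_nonneg hα0 hδ
  intro n y y'
  have hc0 : 0 ≤ c := le_trans (Finset.sum_nonneg fun _ _ => Real.exp_nonneg _) (h261 y)
  exact ineq349_kernel d Gp GA Cinv P B₀ δ₀ Bβ Bε Bεβ B₁ δ₁ U h hL hη hdist hsym htri hB₀ hB₁ (α * δ) δ
    (g.L ^ (4 : ℝ)) (g.L ^ (d : ℝ)) (g.L ^ (2 : ℝ)) (c ^ 3) ((1 - α) * δ) hε (Real.rpow_nonneg hL0 _)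
    (Real.rpow_nonneg hL0 _) (Real.rpow_nonneg hL0 _) (pow_nonneg hc0 3) ha hb hθ hT₄ hTd hTq hconv K₁ K₃ hP
    hK₁ hK₃ n y y'

/-- **"δ determined by δ₀"** — the printed rate ½δ₀ is attainable: with δ₁ = δ₀ ≥ 0 (Theorem 3.2: "with the same
constants"), any 0 ≤ α ≤ ¼ and δ := δ₀ / (2(1−α)) one has (1−α)δ = ½δ₀, δ + 2αδ ≤ δ₀, δ + αδ ≤ δ₀ and δ ≥ 0 — the
rate hypotheses of `ineq349_of_thms31to33`. [cite: Balaban1985BackgroundPropagators, (3.49) p.399] -/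
theorem rates_349 (δ₀ α : ℝ) (hδ₀ : 0 ≤ δ₀) (hα0 : 0 ≤ α) (hα : α ≤ 1 / 4) :
    (1 - α) * (δ₀ / (2 * (1 - α))) = δ₀ / 2 ∧
    δ₀ / (2 * (1 - α)) + 2 * (α * (δ₀ / (2 * (1 - α)))) ≤ δ₀ ∧
    δ₀ / (2 * (1 - α)) + α * (δ₀ / (2 * (1 - α))) ≤ δ₀ ∧
    0 ≤ δ₀ / (2 * (1 - α)) := by
  have h1 : 0 < 1 - α := by linarith
  have h1' : (1 - α) ≠ 0 := ne_of_gt h1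
  have h2 : 0 < 2 * (1 - α) := by linarith
  have h2' : 2 * (1 - α) ≠ 0 := ne_of_gt h2
  refine ⟨?_, ?_, ?_, div_nonneg hδ₀ h2.le⟩
  · field_simp
  · have key : δ₀ / (2 * (1 - α)) + 2 * (α * (δ₀ / (2 * (1 - α)))) = δ₀ * ((1 + 2 * α) / (2 * (1 - α))) := by
      field_simp
    have hr : (1 + 2 * α) / (2 * (1 - α)) ≤ 1 := by rw [div_le_one h2]; linarith
    calc δ₀ / (2 * (1 - α)) + 2 * (α * (δ₀ / (2 * (1 - α)))) = δ₀ * ((1 + 2 * α) / (2 * (1 - α))) := key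
      _ ≤ δ₀ * 1 := mul_le_mul_of_nonneg_left hr hδ₀
      _ = δ₀ := mul_one _
  · have key : δ₀ / (2 * (1 - α)) + α * (δ₀ / (2 * (1 - α))) = δ₀ * ((1 + α) / (2 * (1 - α))) := by
      field_simp
    have hr : (1 + α) / (2 * (1 - α)) ≤ 1 := by rw [div_le_one h2]; linarith
    calc δ₀ / (2 * (1 - α)) + α * (δ₀ / (2 * (1 - α))) = δ₀ * ((1 + α) / (2 * (1 - α))) := key
      _ ≤ δ₀ * 1 := mul_le_mul_of_nonneg_left hr hδ₀
      _ = δ₀ := mul_one _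

end B9Carrier

end Literature.MathematicalPhysics.QuantumFieldTheory.Balaban1983to89.B9Ineq349
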